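import Mathlib
import Summits.Ventures.PercRepro2.CutTwoFarOA
import Summits.Ventures.PercRepro2.LeafStep
import Summits.Ventures.PercRepro2.LeafStepT0

/-!
# `o` and `v` together behind a cut vertex: row (LEAF-½) is a multiple of `T₀`
(blind cell PercRepro2, p5 g29; `proofs/P5-OEDGE.md` §39)

typer-1's two-far-mark machinery for the role pair `{o, a₃}` (`CutTwoFarOA*.lean`; here `a₃` is
the attachment vertex `v` of the row (LEAF-½), the cut vertex is typer-1's `v`) carries the middle
Bernstein coefficient `R½` (`LeafStep.Rhalf`) of the leaf step:

  **`Rhalf_oa3Far_eq`**: with `o, a₃` behind the cut vertex `v` and `a₁, a₂, b` on the right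
  (or at `v`),  `R½ = (q_x1 + q_all / 2) · T₀(o := v)`,
  `q_x1 = P_A(o ↔ v, a₃ ↮ v)`, `q_all = P_A(o ↔ v, a₃ ↔ v)`

— the first-order coefficient `Gc′` is `−q_all · T₀(o := v)` exactly (the whole `a₃`-dependence
of `R½` sits in the one pattern probability `q_all`), so the row is the theorem `T₀ ≥ 0`
(`LeafStep.T0_nonneg`, two BHK 1.4 instances) times a nonnegative weight.  Hence the row on the
whole class (**`LeafRow_oa3Far`**), every admissible weight vector, the left side arbitrary.  The
four extra masses of `R½` and the four masses of the reduced instance are bilinear / linear forms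
in the pattern probabilities and the right atoms (`mUo_oa` … `mUU_red_oa`, generated by own code);
the identity is `∑ q = 1`, `∑ r = 1` and `ring`.  Own work; standard axioms.
-/

namespace Summit.Ventures.PercRepro2

open CovForm CutVertexM9 UnionCluster CutTwoFar LeafStep

namespace LeafRowCutTwoFar

section OA

variable {V : Type*} {E : Type*} [Fintype E] [DecidableEq E] {R : Type*} [Field R]
variable {ends : E → Sym2 V} {side : E → Bool} {L : Set V} {v : V} {Rt : Set V}

/-- `mU(o)` of `R½(o, a₃ far)`. -/
theorem mUo_oa (h : CutVertex ends side L v Rt) (p : E → R) {o b a₁ a₂ a₃ : V} (ho : o ∈ L ∨ o = v) (h1 : a₁ ∈ Rt ∨ a₁ = v) (h2 : a₂ ∈ Rt ∨ a₂ = v) : mU p ends a₁ a₂ o =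
    (patProb ends side v o a₃ p ![true, true, true] + patProb ends side v o a₃ p ![true, false, false]) * (ratom ends side v a₁ a₂ b p ![true, false, true, false, true, false] + ratom ends side v a₁ a₂ b p ![true, false, false, false, false, true] + ratom ends side v a₁ a₂ b p ![true, false, false, false, false, false] + ratom ends side v a₁ a₂ b p ![false, true, true, false, false, true] + ratom ends side v a₁ a₂ b p ![false, true, false, false, true, false] + ratom ends side v a₁ a₂ b p ![false, true, false, false, false, false]) := by
  simp only [mU]
  rw [prob_patLR ends side v a₁ a₂ b o a₃ p (avoidAll ends a₂ {a₁} ∩ connEvent ends a₁ o)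
      (fun τ ρ => (¬ (ρ 3 = true) ∧ (τ 0 = true ∧ ρ 0 = true))) (fun ω => by simp only [Set.mem_inter_iff, mem_connEvent, avoidAll, Set.mem_setOf_eq, Finset.mem_singleton, forall_eq, oa_conn_a₂_a₁ h h1 h2 ω (b := b), oa_conn_a₁_o h ho h1 ω (a₃ := a₃) (a₂ := a₂) (b := b)]),
    prob_patLR ends side v a₁ a₂ b o a₃ p (avoidAll ends a₂ {a₁} ∩ connEvent ends a₂ o)
      (fun τ ρ => (¬ (ρ 3 = true) ∧ (τ 0 = true ∧ ρ 1 = true))) (fun ω => by simp only [Set.mem_inter_iff, mem_connEvent, avoidAll, Set.mem_setOf_eq, Finset.mem_singleton, forall_eq, oa_conn_a₂_a₁ h h1 h2 ω (b := b), oa_conn_a₂_o h ho h2 ω (a₃ := a₃) (a₁ := a₁) (b := b)])]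
  simp only [mix_eq_sum_transPatterns, sum_transPatterns, sum_ite_ratom_eq_sum_transSix, sum_transSix]
  conv_lhs => simp [Fintype.sum_prod_type]
  ring

/-- `mU(b)` of `R½(o, a₃ far)` (a right-side mass). -/
theorem mUb_oa (h : CutVertex ends side L v Rt) (p : E → R) {b a₁ a₂ : V} (h1 : a₁ ∈ Rt ∨ a₁ = v) (h2 : a₂ ∈ Rt ∨ a₂ = v) (hb : b ∈ Rt ∨ b = v) : mU p ends a₁ a₂ b =
    ratom ends side v a₁ a₂ b p ![true, false, true, false, true, false] + ratom ends side v a₁ a₂ b p ![true, false, false, false, false, true] + ratom ends side v a₁ a₂ b p ![false, true, true, false, false, true] + ratom ends side v a₁ a₂ b p ![false, true, false, false, true, false] + ratom ends side v a₁ a₂ b p ![false, false, false, false, true, false] + ratom ends side v a₁ a₂ b p ![false, false, false, false, false, true] := by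
  simp only [mU]
  rw [prob_R6 ends side v a₁ a₂ b p (avoidAll ends a₂ {a₁} ∩ connEvent ends a₁ b)
      (fun ρ => (¬ (ρ 3 = true) ∧ ρ 4 = true)) (fun ω => by simp only [Set.mem_inter_iff, mem_connEvent, avoidAll, Set.mem_setOf_eq, Finset.mem_singleton, forall_eq, oa_conn_a₂_a₁ h h1 h2 ω (b := b), oa_conn_a₁_b h h1 hb ω (a₂ := a₂)]),
    prob_R6 ends side v a₁ a₂ b p (avoidAll ends a₂ {a₁} ∩ connEvent ends a₂ b)
      (fun ρ => (¬ (ρ 3 = true) ∧ ρ 5 = true)) (fun ω => by simp only [Set.mem_inter_iff, mem_connEvent, avoidAll, Set.mem_setOf_eq, Finset.mem_singleton, forall_eq, oa_conn_a₂_a₁ h h1 h2 ω (b := b), oa_conn_a₂_b h h2 hb ω (a₁ := a₁)])]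
  simp only [sum_ite_ratom_eq_sum_transSix, sum_transSix]
  conv_lhs => simp [Fintype.sum_prod_type]
  ring

/-- `mU(a₃)` of `R½(o, a₃ far)`. -/
theorem mUa3_oa (h : CutVertex ends side L v Rt) (p : E → R) {o b a₁ a₂ a₃ : V} (h3 : a₃ ∈ L ∨ a₃ = v) (h1 : a₁ ∈ Rt ∨ a₁ = v) (h2 : a₂ ∈ Rt ∨ a₂ = v) : mU p ends a₁ a₂ a₃ =
    (patProb ends side v o a₃ p ![true, true, true] + patProb ends side v o a₃ p ![false, true, false]) * (ratom ends side v a₁ a₂ b p ![true, false, true, false, true, false] + ratom ends side v a₁ a₂ b p ![true, false, false, false, false, true] + ratom ends side v a₁ a₂ b p ![true, false, false, false, false, false] + ratom ends side v a₁ a₂ b p ![false, true, true, false, false, true] + ratom ends side v a₁ a₂ b p ![false, true, false, false, true, false] + ratom ends side v a₁ a₂ b p ![false, true, false, false, false, false]) := by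
  simp only [mU]
  rw [prob_patLR ends side v a₁ a₂ b o a₃ p (avoidAll ends a₂ {a₁} ∩ connEvent ends a₁ a₃)
      (fun τ ρ => (¬ (ρ 3 = true) ∧ (τ 1 = true ∧ ρ 0 = true))) (fun ω => by simp only [Set.mem_inter_iff, mem_connEvent, avoidAll, Set.mem_setOf_eq, Finset.mem_singleton, forall_eq, oa_conn_a₂_a₁ h h1 h2 ω (b := b), oa_conn_a₁_a₃ h h3 h1 ω (o := o) (a₂ := a₂) (b := b)]),
    prob_patLR ends side v a₁ a₂ b o a₃ p (avoidAll ends a₂ {a₁} ∩ connEvent ends a₂ a₃)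
      (fun τ ρ => (¬ (ρ 3 = true) ∧ (τ 1 = true ∧ ρ 1 = true))) (fun ω => by simp only [Set.mem_inter_iff, mem_connEvent, avoidAll, Set.mem_setOf_eq, Finset.mem_singleton, forall_eq, oa_conn_a₂_a₁ h h1 h2 ω (b := b), oa_conn_a₂_a₃ h h3 h2 ω (o := o) (a₁ := a₁) (b := b)])]
  simp only [mix_eq_sum_transPatterns, sum_transPatterns, sum_ite_ratom_eq_sum_transSix, sum_transSix]
  conv_lhs => simp [Fintype.sum_prod_type]
  ring

/-- `mUU` of `R½(o, a₃ far)`. -/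
theorem mUU_oa (h : CutVertex ends side L v Rt) (p : E → R) {o b a₁ a₂ a₃ : V} (ho : o ∈ L ∨ o = v) (h1 : a₁ ∈ Rt ∨ a₁ = v) (h2 : a₂ ∈ Rt ∨ a₂ = v) (hb : b ∈ Rt ∨ b = v) : mUU p ends o a₁ a₂ b =
    (patProb ends side v o a₃ p ![true, true, true] + patProb ends side v o a₃ p ![true, false, false]) * (ratom ends side v a₁ a₂ b p ![true, false, true, false, true, false] + ratom ends side v a₁ a₂ b p ![true, false, false, false, false, true] + ratom ends side v a₁ a₂ b p ![false, true, true, false, false, true] + ratom ends side v a₁ a₂ b p ![false, true, false, false, true, false]) := by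
  simp only [mUU]
  rw [prob_patLR ends side v a₁ a₂ b o a₃ p (avoidAll ends a₂ {a₁} ∩ (connEvent ends a₁ o ∩ connEvent ends a₁ b))
      (fun τ ρ => (¬ (ρ 3 = true) ∧ ((τ 0 = true ∧ ρ 0 = true) ∧ ρ 4 = true))) (fun ω => by simp only [Set.mem_inter_iff, mem_connEvent, avoidAll, Set.mem_setOf_eq, Finset.mem_singleton, forall_eq, oa_conn_a₂_a₁ h h1 h2 ω (b := b), oa_conn_a₁_o h ho h1 ω (a₃ := a₃) (a₂ := a₂) (b := b), oa_conn_a₁_b h h1 hb ω (a₂ := a₂)]),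
    prob_patLR ends side v a₁ a₂ b o a₃ p (avoidAll ends a₂ {a₁} ∩ (connEvent ends a₂ o ∩ connEvent ends a₂ b))
      (fun τ ρ => (¬ (ρ 3 = true) ∧ ((τ 0 = true ∧ ρ 1 = true) ∧ ρ 5 = true))) (fun ω => by simp only [Set.mem_inter_iff, mem_connEvent, avoidAll, Set.mem_setOf_eq, Finset.mem_singleton, forall_eq, oa_conn_a₂_a₁ h h1 h2 ω (b := b), oa_conn_a₂_o h ho h2 ω (a₃ := a₃) (a₁ := a₁) (b := b), oa_conn_a₂_b h h2 hb ω (a₁ := a₁)]),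
    prob_patLR ends side v a₁ a₂ b o a₃ p (avoidAll ends a₂ {a₁} ∩ (connEvent ends a₂ o ∩ connEvent ends a₁ b))
      (fun τ ρ => (¬ (ρ 3 = true) ∧ ((τ 0 = true ∧ ρ 1 = true) ∧ ρ 4 = true))) (fun ω => by simp only [Set.mem_inter_iff, mem_connEvent, avoidAll, Set.mem_setOf_eq, Finset.mem_singleton, forall_eq, oa_conn_a₂_a₁ h h1 h2 ω (b := b), oa_conn_a₂_o h ho h2 ω (a₃ := a₃) (a₁ := a₁) (b := b), oa_conn_a₁_b h h1 hb ω (a₂ := a₂)]),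
    prob_patLR ends side v a₁ a₂ b o a₃ p (avoidAll ends a₂ {a₁} ∩ (connEvent ends a₁ o ∩ connEvent ends a₂ b))
      (fun τ ρ => (¬ (ρ 3 = true) ∧ ((τ 0 = true ∧ ρ 0 = true) ∧ ρ 5 = true))) (fun ω => by simp only [Set.mem_inter_iff, mem_connEvent, avoidAll, Set.mem_setOf_eq, Finset.mem_singleton, forall_eq, oa_conn_a₂_a₁ h h1 h2 ω (b := b), oa_conn_a₁_o h ho h1 ω (a₃ := a₃) (a₂ := a₂) (b := b), oa_conn_a₂_b h h2 hb ω (a₁ := a₁)])]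
  simp only [mix_eq_sum_transPatterns, sum_transPatterns, sum_ite_ratom_eq_sum_transSix, sum_transSix]
  conv_lhs => simp [Fintype.sum_prod_type]
  ring

/-- `EQbo` of the reduced instance (`o := v`). -/
theorem EQbo_red_oa (h : CutVertex ends side L v Rt) (p : E → R) {b a₁ a₂ : V} (h1 : a₁ ∈ Rt ∨ a₁ = v) (h2 : a₂ ∈ Rt ∨ a₂ = v) (hb : b ∈ Rt ∨ b = v) : EQbo p ends v a₁ a₂ b =
    ratom ends side v a₁ a₂ b p ![true, false, true, false, true, false] + ratom ends side v a₁ a₂ b p ![false, true, true, false, false, true] - ratom ends side v a₁ a₂ b p ![true, false, false, false, false, true] - ratom ends side v a₁ a₂ b p ![false, true, false, false, true, false] := by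
  simp only [EQbo]
  rw [prob_R6 ends side v a₁ a₂ b p (avoidAll ends a₂ {a₁} ∩ (connEvent ends a₁ v ∩ connEvent ends a₁ b))
      (fun ρ => (¬ (ρ 3 = true) ∧ (ρ 0 = true ∧ ρ 4 = true))) (fun ω => by simp only [Set.mem_inter_iff, mem_connEvent, avoidAll, Set.mem_setOf_eq, Finset.mem_singleton, forall_eq, oa_conn_a₂_a₁ h h1 h2 ω (b := b), oa_conn_a₁_v h h1 ω (a₂ := a₂) (b := b), oa_conn_a₁_b h h1 hb ω (a₂ := a₂)]),
    prob_R6 ends side v a₁ a₂ b p (avoidAll ends a₂ {a₁} ∩ (connEvent ends a₂ v ∩ connEvent ends a₂ b))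
      (fun ρ => (¬ (ρ 3 = true) ∧ (ρ 1 = true ∧ ρ 5 = true))) (fun ω => by simp only [Set.mem_inter_iff, mem_connEvent, avoidAll, Set.mem_setOf_eq, Finset.mem_singleton, forall_eq, oa_conn_a₂_a₁ h h1 h2 ω (b := b), oa_conn_a₂_v h h2 ω (a₁ := a₁) (b := b), oa_conn_a₂_b h h2 hb ω (a₁ := a₁)]),
    prob_R6 ends side v a₁ a₂ b p (avoidAll ends a₂ {a₁} ∩ (connEvent ends a₂ v ∩ connEvent ends a₁ b))
      (fun ρ => (¬ (ρ 3 = true) ∧ (ρ 1 = true ∧ ρ 4 = true))) (fun ω => by simp only [Set.mem_inter_iff, mem_connEvent, avoidAll, Set.mem_setOf_eq, Finset.mem_singleton, forall_eq, oa_conn_a₂_a₁ h h1 h2 ω (b := b), oa_conn_a₂_v h h2 ω (a₁ := a₁) (b := b), oa_conn_a₁_b h h1 hb ω (a₂ := a₂)]),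
    prob_R6 ends side v a₁ a₂ b p (avoidAll ends a₂ {a₁} ∩ (connEvent ends a₁ v ∩ connEvent ends a₂ b))
      (fun ρ => (¬ (ρ 3 = true) ∧ (ρ 0 = true ∧ ρ 5 = true))) (fun ω => by simp only [Set.mem_inter_iff, mem_connEvent, avoidAll, Set.mem_setOf_eq, Finset.mem_singleton, forall_eq, oa_conn_a₂_a₁ h h1 h2 ω (b := b), oa_conn_a₁_v h h1 ω (a₂ := a₂) (b := b), oa_conn_a₂_b h h2 hb ω (a₁ := a₁)])]
  simp only [sum_ite_ratom_eq_sum_transSix, sum_transSix]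
  conv_lhs => simp [Fintype.sum_prod_type]
  ring

/-- `EQo` of the reduced instance (`o := v`). -/
theorem EQo_red_oa (h : CutVertex ends side L v Rt) (p : E → R) {b a₁ a₂ : V} (h1 : a₁ ∈ Rt ∨ a₁ = v) (h2 : a₂ ∈ Rt ∨ a₂ = v) : EQo p ends v a₁ a₂ =
    ratom ends side v a₁ a₂ b p ![true, false, true, false, true, false] + ratom ends side v a₁ a₂ b p ![true, false, false, false, false, true] + ratom ends side v a₁ a₂ b p ![true, false, false, false, false, false] - ratom ends side v a₁ a₂ b p ![false, true, true, false, false, true] - ratom ends side v a₁ a₂ b p ![false, true, false, false, true, false] - ratom ends side v a₁ a₂ b p ![false, true, false, false, false, false] := by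
  simp only [EQo]
  rw [prob_R6 ends side v a₁ a₂ b p (avoidAll ends a₂ {a₁} ∩ connEvent ends a₁ v)
      (fun ρ => (¬ (ρ 3 = true) ∧ ρ 0 = true)) (fun ω => by simp only [Set.mem_inter_iff, mem_connEvent, avoidAll, Set.mem_setOf_eq, Finset.mem_singleton, forall_eq, oa_conn_a₂_a₁ h h1 h2 ω (b := b), oa_conn_a₁_v h h1 ω (a₂ := a₂) (b := b)]),
    prob_R6 ends side v a₁ a₂ b p (avoidAll ends a₂ {a₁} ∩ connEvent ends a₂ v)
      (fun ρ => (¬ (ρ 3 = true) ∧ ρ 1 = true)) (fun ω => by simp only [Set.mem_inter_iff, mem_connEvent, avoidAll, Set.mem_setOf_eq, Finset.mem_singleton, forall_eq, oa_conn_a₂_a₁ h h1 h2 ω (b := b), oa_conn_a₂_v h h2 ω (a₁ := a₁) (b := b)])]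
  simp only [sum_ite_ratom_eq_sum_transSix, sum_transSix]
  conv_lhs => simp [Fintype.sum_prod_type]
  ring

/-- `mU(v)` of the reduced instance. -/
theorem mUv_red_oa (h : CutVertex ends side L v Rt) (p : E → R) {b a₁ a₂ : V} (h1 : a₁ ∈ Rt ∨ a₁ = v) (h2 : a₂ ∈ Rt ∨ a₂ = v) : mU p ends a₁ a₂ v =
    ratom ends side v a₁ a₂ b p ![true, false, true, false, true, false] + ratom ends side v a₁ a₂ b p ![true, false, false, false, false, true] + ratom ends side v a₁ a₂ b p ![true, false, false, false, false, false] + ratom ends side v a₁ a₂ b p ![false, true, true, false, false, true] + ratom ends side v a₁ a₂ b p ![false, true, false, false, true, false] + ratom ends side v a₁ a₂ b p ![false, true, false, false, false, false] := by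
  simp only [mU]
  rw [prob_R6 ends side v a₁ a₂ b p (avoidAll ends a₂ {a₁} ∩ connEvent ends a₁ v)
      (fun ρ => (¬ (ρ 3 = true) ∧ ρ 0 = true)) (fun ω => by simp only [Set.mem_inter_iff, mem_connEvent, avoidAll, Set.mem_setOf_eq, Finset.mem_singleton, forall_eq, oa_conn_a₂_a₁ h h1 h2 ω (b := b), oa_conn_a₁_v h h1 ω (a₂ := a₂) (b := b)]),
    prob_R6 ends side v a₁ a₂ b p (avoidAll ends a₂ {a₁} ∩ connEvent ends a₂ v)
      (fun ρ => (¬ (ρ 3 = true) ∧ ρ 1 = true)) (fun ω => by simp only [Set.mem_inter_iff, mem_connEvent, avoidAll, Set.mem_setOf_eq, Finset.mem_singleton, forall_eq, oa_conn_a₂_a₁ h h1 h2 ω (b := b), oa_conn_a₂_v h h2 ω (a₁ := a₁) (b := b)])]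
  simp only [sum_ite_ratom_eq_sum_transSix, sum_transSix]
  conv_lhs => simp [Fintype.sum_prod_type]
  ring

/-- `mUU` of the reduced instance (`o := v`). -/
theorem mUU_red_oa (h : CutVertex ends side L v Rt) (p : E → R) {b a₁ a₂ : V} (h1 : a₁ ∈ Rt ∨ a₁ = v) (h2 : a₂ ∈ Rt ∨ a₂ = v) (hb : b ∈ Rt ∨ b = v) : mUU p ends v a₁ a₂ b =
    ratom ends side v a₁ a₂ b p ![true, false, true, false, true, false] + ratom ends side v a₁ a₂ b p ![true, false, false, false, false, true] + ratom ends side v a₁ a₂ b p ![false, true, true, false, false, true] + ratom ends side v a₁ a₂ b p ![false, true, false, false, true, false] := by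
  simp only [mUU]
  rw [prob_R6 ends side v a₁ a₂ b p (avoidAll ends a₂ {a₁} ∩ (connEvent ends a₁ v ∩ connEvent ends a₁ b))
      (fun ρ => (¬ (ρ 3 = true) ∧ (ρ 0 = true ∧ ρ 4 = true))) (fun ω => by simp only [Set.mem_inter_iff, mem_connEvent, avoidAll, Set.mem_setOf_eq, Finset.mem_singleton, forall_eq, oa_conn_a₂_a₁ h h1 h2 ω (b := b), oa_conn_a₁_v h h1 ω (a₂ := a₂) (b := b), oa_conn_a₁_b h h1 hb ω (a₂ := a₂)]),
    prob_R6 ends side v a₁ a₂ b p (avoidAll ends a₂ {a₁} ∩ (connEvent ends a₂ v ∩ connEvent ends a₂ b))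
      (fun ρ => (¬ (ρ 3 = true) ∧ (ρ 1 = true ∧ ρ 5 = true))) (fun ω => by simp only [Set.mem_inter_iff, mem_connEvent, avoidAll, Set.mem_setOf_eq, Finset.mem_singleton, forall_eq, oa_conn_a₂_a₁ h h1 h2 ω (b := b), oa_conn_a₂_v h h2 ω (a₁ := a₁) (b := b), oa_conn_a₂_b h h2 hb ω (a₁ := a₁)]),
    prob_R6 ends side v a₁ a₂ b p (avoidAll ends a₂ {a₁} ∩ (connEvent ends a₂ v ∩ connEvent ends a₁ b))
      (fun ρ => (¬ (ρ 3 = true) ∧ (ρ 1 = true ∧ ρ 4 = true))) (fun ω => by simp only [Set.mem_inter_iff, mem_connEvent, avoidAll, Set.mem_setOf_eq, Finset.mem_singleton, forall_eq, oa_conn_a₂_a₁ h h1 h2 ω (b := b), oa_conn_a₂_v h h2 ω (a₁ := a₁) (b := b), oa_conn_a₁_b h h1 hb ω (a₂ := a₂)]),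
    prob_R6 ends side v a₁ a₂ b p (avoidAll ends a₂ {a₁} ∩ (connEvent ends a₁ v ∩ connEvent ends a₂ b))
      (fun ρ => (¬ (ρ 3 = true) ∧ (ρ 0 = true ∧ ρ 5 = true))) (fun ω => by simp only [Set.mem_inter_iff, mem_connEvent, avoidAll, Set.mem_setOf_eq, Finset.mem_singleton, forall_eq, oa_conn_a₂_a₁ h h1 h2 ω (b := b), oa_conn_a₁_v h h1 ω (a₂ := a₂) (b := b), oa_conn_a₂_b h h2 hb ω (a₁ := a₁)])]
  simp only [sum_ite_ratom_eq_sum_transSix, sum_transSix]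
  conv_lhs => simp [Fintype.sum_prod_type]
  ring

/-- **`R½` WITH `o` AND `a₃` BEHIND THE CUT VERTEX IS A MULTIPLE OF `T₀`**: `R½ = (q_x1 + q_all / 2) · T₀(o := v)`,
`q_x1 = P_A(o ↔ v, a₃ ↮ v)`, `q_all = P_A(o ↔ v, a₃ ↔ v)`. -/
theorem Rhalf_oa3Far_eq [LinearOrder R] [IsStrictOrderedRing R] (h : CutVertex ends side L v Rt)
    (p : E → R) {o b a₁ a₂ a₃ : V}
    (ho : o ∈ L ∨ o = v) (h3 : a₃ ∈ L ∨ a₃ = v) (h1 : a₁ ∈ Rt ∨ a₁ = v) (h2 : a₂ ∈ Rt ∨ a₂ = v)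
    (hb : b ∈ Rt ∨ b = v) :
    Rhalf p ends o a₁ a₂ a₃ b =
      (patProb ends side v o a₃ p ![true, false, false] + patProb ends side v o a₃ p ![true, true, true] / 2) *
        T0 p ends v a₁ a₂ b := by
  have hq := sum_patProb_transPatterns ends side v o a₃ p
  rw [sum_transPatterns] at hq
  have hr := ratom_sum_transSix ends side v a₁ a₂ b p
  rw [sum_transSix] at hr
  have hqs : patProb ends side v o a₃ p ![false, false, false] = 1 - (patProb ends side v o a₃ p ![true, true, true] + patProb ends side v o a₃ p ![true, false, false] + patProb ends side v o a₃ p ![false, true, false] + patProb ends side v o a₃ p ![false, false, true]) := by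
    linear_combination hq
  have hrs : ratom ends side v a₁ a₂ b p ![false, false, false, false, false, false] = 1 - (ratom ends side v a₁ a₂ b p ![true, true, true, true, true, true] + ratom ends side v a₁ a₂ b p ![true, true, false, true, false, false] + ratom ends side v a₁ a₂ b p ![true, false, true, false, true, false] + ratom ends side v a₁ a₂ b p ![true, false, false, false, false, true] + ratom ends side v a₁ a₂ b p ![true, false, false, false, false, false] + ratom ends side v a₁ a₂ b p ![false, true, true, false, false, true] + ratom ends side v a₁ a₂ b p ![false, true, false, false, true, false] + ratom ends side v a₁ a₂ b p ![false, true, false, false, false, false] + ratom ends side v a₁ a₂ b p ![false, false, true, true, false, false] + ratom ends side v a₁ a₂ b p ![false, false, true, false, false, false] + ratom ends side v a₁ a₂ b p ![false, false, false, true, true, true] + ratom ends side v a₁ a₂ b p ![false, false, false, true, false, false] + ratom ends side v a₁ a₂ b p ![false, false, false, false, true, false] + ratom ends side v a₁ a₂ b p ![false, false, false, false, false, true]) := by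
    linear_combination hr
  unfold Rhalf T0 Gc1
  rw [PQ_oa (o := o) (a₃ := a₃) (b := b) h p h1 h2,
    EQbo_oa (a₃ := a₃) h p ho h1 h2 hb,
    EQb3_oa (o := o) h p h3 h1 h2 hb,
    EQb3o_oa h p ho h3 h1 h2 hb,
    gap_oa (o := o) (a₃ := a₃) h p h1 h2 hb,
    EQo_oa (a₃ := a₃) (b := b) h p ho h1 h2,
    EQ3_oa (o := o) (b := b) h p h3 h1 h2,
    EQ3o_oa (b := b) h p ho h3 h1 h2,
    PDb_oa (o := o) h p h3 h1 h2 hb,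
    PDbo_oa h p ho h3 h1 h2 hb,
    Do_oa (b := b) h p ho h3 h1 h2,
    mUo_oa (b := b) (a₃ := a₃) h p ho h1 h2,
    mUb_oa h p h1 h2 hb,
    mUa3_oa (o := o) (b := b) h p h3 h1 h2,
    mUU_oa (a₃ := a₃) h p ho h1 h2 hb,
    EQbo_red_oa h p h1 h2 hb,
    EQo_red_oa (b := b) h p h1 h2,
    mUv_red_oa (b := b) h p h1 h2,
    mUU_red_oa h p h1 h2 hb, hqs, hrs]
  ring

/-- **Row (LEAF-½) with `o` and the attachment vertex `a₃` together behind a cut vertex**, every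
admissible weight vector, the left side arbitrary: a nonnegative multiple of the theorem `T₀ ≥ 0`. -/
theorem LeafRow_oa3Far [Fintype V] [DecidableEq V] [LinearOrder R] [IsStrictOrderedRing R]
    (h : CutVertex ends side L v Rt) {p : E → R} (hp : IsProbVec p) {o b a₁ a₂ a₃ : V}
    (ho : o ∈ L ∨ o = v) (h3 : a₃ ∈ L ∨ a₃ = v) (h1 : a₁ ∈ Rt ∨ a₁ = v) (h2 : a₂ ∈ Rt ∨ a₂ = v)
    (hb : b ∈ Rt ∨ b = v) : LeafRow p ends o a₁ a₂ a₃ b := by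
  unfold LeafRow
  rw [Rhalf_oa3Far_eq h p ho h3 h1 h2 hb]
  have hq : ∀ τ, 0 ≤ patProb ends side v o a₃ p τ := fun τ => prob_nonneg hp _
  have hT := T0_nonneg p ends hp v a₁ a₂ b
  have h2' : (0 : R) ≤ 2 := by norm_num
  exact mul_nonneg (add_nonneg (hq _) (div_nonneg (hq _) h2')) hT

end OA

end LeafRowCutTwoFar

end Summit.Ventures.PercRepro2
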